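import Summits.QuantumFields.BalabanUV.T4Continuum.Support.ShellMeasureDecayComplexRay
import Summits.QuantumFields.BalabanUV.Beta.MultiscaleDistanceMetric

/-!
# `T4Continuum.ShellMeasureDecaySignedRemainder` — THE (81)-PERTURBATION BOOKKEEPING: E1∕E6 of the MODEL operator survive a
# SIGNED remainder that is local in the scale-adapted distance and of local-gap size — the k-uniform decay of `(levelOp + P)⁻¹`
# for an INDEFINITE `P` under two sitewise budgets (form from below, conjugation defect), both read off three numbers
(cell `pub-balaban`, sub-cell `t4`, spine estimate NE7c (node U5b); NE7c ROUND-2 crew `t4-ne7c-formalise-*`, unit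
`b2b-balaban-t4-ne7c-formalise-leaf-05` gen 13; journal INTENT I-ne7cL05g13-1 (2026-08-21, l.25065) → OFFER to the owner
`t4/b2b-balaban-t4-ne7c-p1/LEAVES-NE7c-P1.md` (post-v6 ESTIMATE LANE; R-ne7cp1-g37-13: new J-files only on the owner's word — this file is
STAGED for that word); the SIGNED twin of ROW S121 = J6 `ShellMeasureDecayComplexRay` (leaf-10-g15, p243718 ✓), whose END needs
`Re z^*Pz ≥ 0`; residual named in the owner's census `ONECALL-CENSUS-NE7c.md` §13 addendum 1 («plus the (81)-perturbation bookkeeping»)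
and R-ne7cp1-g37-14 (b) («(80)–(81)'s curvature terms»); leaf-05-g12's J1 memo (D5)∕(D7)∕(D8); ADDITIVE — imports J6 file 1 and
`Beta/MultiscaleDistanceMetric` (triangle inequality of `d_n` on the torus) ONLY and touches NO host; [folklore]; 0 `def`,
0 `def … : Prop`, 0 sorry, 0 citation tags of Bałaban's.)

HONEST FRAMING.  Finite four-torus programme, rung (B)+1 only — NOT infinite volume, NOT a mass gap, NOT the Clay problem, NOT
summit progress.  NE7c (`T4IndicatorShell.ShellWeightBound`) is NOT PRINTED in [Balaban 1983–89] and NOT PROVED; «NE7c ⇐ the named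
binders» (trigger c3).  THIS FILE is a lemma of OURS about the MODEL operator `levelOp` ([Balaban1985BackgroundPropagators] (3.24)
SHAPE, `Literature/…/B9Thm37GlueTorusCovLevels.levelOp`): the ENTRY-level decay END `Beta/MultiscaleDecay.decay_levelOp` (beta-d4-p2)
survives the addition of a remainder `P` that may LOWER the quadratic form — `−θ′·μ₀·Σ_e n(e)⁻²‖z_e‖² ≤ Re z^*Pz` — as long as
`θ + θ′ < 1`, `θ` being J6's sitewise conjugation-defect budget.  The remainder species it is written for is the (81)-type
perturbation of the linearised variational form of [Balaban1985Variational] (79)–(81): the curvature∕`V₀″`∕`J(U₀)` terms are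
REAL, INDEFINITE, plaquette-local and «O(field size)», i.e. `O(α₀)·n⁻²` in the local-gap units of the J1 dictionary (D5) — the
case J6's `hP : 0 ≤ Re z^*Pz` (the complex contraction ray's anti-Hermitian∕accretive remainder) does not cover.  It does NOT
say that Bałaban's `Δ₁ + D^*RD + aQ^*Q` IS `levelOp + P` for such a `P` (node O's identification, the NEXT owner generation's
junction ruling, R-ne7cp1-g37-13 (c)); it does not touch the `D^*RD` term (ROW S120 = J5) nor the `H₁`∕`H` algebra (S122∕S123); it is
an ℓ²-ENTRY statement (the cell∕sup∕gradient upgrades are J3 ∕ `ShellMeasureDecayRowsSupCells` ∕ the β crew's gradient chain).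
WHY A FORM-LEVEL LEMMA AND NOT COMPOSITION: the Neumann route `(A + P)⁻¹ = A⁻¹Σ(−PA⁻¹)ⁿ` over the entry END's LOCAL prefactors
`n(p)n(q)` is NOT level-free — one factor `PA⁻¹` costs `(β·n⁻²)·(n^d sites)·(n²∕μ₀)` — so neither S122 = J7's `compKer` currency nor
`Beta/DecayingKernelNeumann` delivers the k-uniform statement; in the quadratic form the remainder enters SITEWISE against the local
gap `μ₀·n⁻²` and the condition is the pure number `β·e^{κr} < μ₀`.  No END host is touched; census COUNT unchanged; nothing of
Bałaban's asserted, cited or discharged.  HONEST DEPENDENCY (cell): continuum YM on T⁴ ⇐ BetaPertH ∧ nine spine estimates (0/9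
proved); BetaPertH ⇐ (D1) ∧ (D4) ∧ CAP+tail; G-an2-4 gates asym, D1 and NE2/3/4.

CONTENT.  §1 (abstract, `Matrix ι ι ℂ`): `re_form_ge_neg_of_rowCol` (Schur: sitewise absolute row∕column sums `≤ λ_e` ⟹
`−Σ λ_e‖z_e‖² ≤ Re z^*Pz`); **`localConjCoercive_add_of_lowerBounded_budget`** (profile `μ` for `A`, form budget `θ′μ` and defect
budget `θμ` for `P` ⟹ profile `(1 − θ − θ′)μ` for `A + P`); **`norm_inv_add_le_local_of_lowerBounded`** (`θ + θ′ < 1` ⟹ `A + P` is a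
unit and `‖(A + P)⁻¹(i,j)‖ ≤ e^{−κd(i,j)}∕((1 − θ − θ′)√(μ_iμ_j))`); `abs_sub_le_of_symm_triangle`, `expRowDefect_le_of_range_site`,
`expColDefect_le_of_range_site` (sitewise versions of `Beta/AccretiveCombesThomasBudget.expRowDefect_le_of_range`);
`budgets_of_signedLocal` (§2: the two budgets `θ′ = β∕m`, `θ = β(e^{κr} − 1)∕m` read off range + sitewise row∕column sums, any gap `m`).
§2 (MODEL): **`decay_levelOp_add_signed`** = `MultiscaleDecay.decay_levelOp`'s binders + `P θ θ′ hPform hJ` ⟹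
`IsUnit (cmat levelOp + P) ∧ ‖(cmat levelOp + P)⁻¹ p q‖ ≤ e^{−κ·d_n(p₁,q₁)}·n(p₁)n(q₁)∕((1 − θ − θ′)μ₀)`;
**`decay_levelOp_add_signedLocal`** = the same with BOTH budgets DERIVED from three numbers: `d_n`-range `r` (`P e e′ ≠ 0 → d_n(e₁,e′₁) ≤ r`),
sitewise absolute row AND column sums `≤ β·n(e₁)⁻²`, and the level-free smallness `β·e^{κr} < μ₀` ⟹ denominator `μ₀ − β·e^{κr}`;
companion file 2 `ShellMeasureDecaySignedRemainderCov`: the COVARIANT instance under the (3.35)-shape gauge (`_cov`) and the witness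
that the SIGNED clause is inhabited by a remainder outside J6's (`decay_levelOp_sub_localGap`: `P := −β·diag(n⁻²)`, `β < μ₀`).
-/

noncomputable section

open scoped BigOperators Matrix ComplexConjugate
open Finset Function Complex Matrix

namespace Summit.QuantumFields.BalabanUV.T4Continuum.ShellMeasureDecaySignedRemainder

open Summit.QuantumFields.BalabanUV.Beta
open Summit.QuantumFields.BalabanUV.Beta.BoxPoincare (Box)
open Summit.QuantumFields.BalabanUV.Beta.CovariantBoxPoincare (hol)
open Summit.QuantumFields.BalabanUV.Beta.MultiscaleCoerciveTorus
open Summit.QuantumFields.BalabanUV.Beta.MultiscaleCoerciveTorusCov (multiscale_coercive_torus_cov)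
open Summit.QuantumFields.BalabanUV.Beta.MultiscaleDecayBudget (siteScale one_le_siteScale)
open Summit.QuantumFields.BalabanUV.Beta.MultiscaleDistance (sdist sdist_self sdist_nonneg)
open Summit.QuantumFields.BalabanUV.Beta.MultiscaleDistanceMetric (sdist_comm sdist_triangle_torus)
open Summit.QuantumFields.BalabanUV.Beta.MultiscaleDecay (hc_levelOp)
open Summit.QuantumFields.BalabanUV.Beta.AccretiveCombesThomas (conjForm conjForm_add star_dotProduct_mulVec_eq)
open Summit.QuantumFields.BalabanUV.Beta.AccretiveCombesThomasBudget (expWeight expWeight_nonneg expRowDefect expColDefect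
  expWeight_le_of_abs_sub_le)
open Summit.QuantumFields.BalabanUV.Beta.MultiscaleCombesThomas (norm_inv_apply_le_local isUnit_of_localConjCoercive)
open Summit.QuantumFields.BalabanUV.Beta.MultiscaleCombesThomasBudget (localLower_of_expDefect localConjCoercive_of_real realConjForm
  realConjForm_toMatrix')
open Summit.QuantumFields.BalabanUV.Beta.CovariantTowerMatrix (cmat)
open Summit.QuantumFields.BalabanUV.T4Continuum.ShellMeasureDecayComplexRay (localConjCoercive_add_of_re_nonneg_budget)
open Literature.MathematicalPhysics.QuantumFieldTheory.Balaban1983to89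
open Literature.MathematicalPhysics.QuantumFieldTheory.Balaban1983to89.B9Thm37GluePU (bsrc btgt)
open Literature.MathematicalPhysics.QuantumFieldTheory.Balaban1983to89.B9Thm37GlueTorusCov (tblk torusComb)
open Literature.MathematicalPhysics.QuantumFieldTheory.Balaban1983to89.B9Thm37GlueTorusCovLevels (levelOp)
open B5TorusCover (UT Ctr ctrU)

/-! ## §1 Abstract: a SIGNED remainder costs its form budget from below plus its sitewise conjugation defect -/

section Abstract

variable {ι : Type*} [Fintype ι] [DecidableEq ι]

omit [DecidableEq ι] in
/-- **Schur's test for the quadratic form, sitewise**: absolute row sums `Σ_{e′}‖P e e′‖ ≤ λ_e` AND column sums `Σ_e‖P e e′‖ ≤ λ_{e′}`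
give `−Σ_e λ_e‖z_e‖² ≤ Re z^*Pz` (AM–GM on `|z_e||P e e′||z_{e′}|`). [folklore] -/
theorem re_form_ge_neg_of_rowCol (P : Matrix ι ι ℂ) (lam : ι → ℝ)
    (hrow : ∀ e, ∑ e', ‖P e e'‖ ≤ lam e) (hcol : ∀ e', ∑ e, ‖P e e'‖ ≤ lam e') (z : ι → ℂ) :
    -(∑ e, lam e * ‖z e‖ ^ 2) ≤ (star z ⬝ᵥ (P *ᵥ z)).re := by
  have hnorm : ‖star z ⬝ᵥ (P *ᵥ z)‖ ≤ ∑ e, ∑ e', ‖z e‖ * ‖P e e'‖ * ‖z e'‖ := by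
    rw [star_dotProduct_mulVec_eq]
    refine (norm_sum_le _ _).trans (Finset.sum_le_sum fun e _ => ?_)
    refine (norm_sum_le _ _).trans (Finset.sum_le_sum fun e' _ => ?_)
    rw [norm_mul, norm_mul, Complex.norm_conj]
  have hamgm : ∑ e, ∑ e', ‖z e‖ * ‖P e e'‖ * ‖z e'‖
      ≤ (∑ e, ‖z e‖ ^ 2 / 2 * ∑ e', ‖P e e'‖) + ∑ e', ‖z e'‖ ^ 2 / 2 * ∑ e, ‖P e e'‖ := by
    have h1 : ∑ e, ∑ e', ‖z e‖ * ‖P e e'‖ * ‖z e'‖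
        ≤ ∑ e, ∑ e', (‖z e‖ ^ 2 / 2 * ‖P e e'‖ + ‖z e'‖ ^ 2 / 2 * ‖P e e'‖) := by
      refine Finset.sum_le_sum fun e _ => Finset.sum_le_sum fun e' _ => ?_
      have hw : 0 ≤ ‖P e e'‖ := norm_nonneg _
      have : ‖z e‖ * ‖z e'‖ ≤ ‖z e‖ ^ 2 / 2 + ‖z e'‖ ^ 2 / 2 := by nlinarith [sq_nonneg (‖z e‖ - ‖z e'‖)]
      calc ‖z e‖ * ‖P e e'‖ * ‖z e'‖ = (‖z e‖ * ‖z e'‖) * ‖P e e'‖ := by ring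
        _ ≤ (‖z e‖ ^ 2 / 2 + ‖z e'‖ ^ 2 / 2) * ‖P e e'‖ := mul_le_mul_of_nonneg_right this hw
        _ = _ := by ring
    refine h1.trans (le_of_eq ?_)
    rw [Finset.sum_congr rfl fun e _ => Finset.sum_add_distrib, Finset.sum_add_distrib]
    congr 1
    · exact Finset.sum_congr rfl fun e _ => by rw [Finset.mul_sum]
    · rw [Finset.sum_comm]
      exact Finset.sum_congr rfl fun e' _ => by rw [Finset.mul_sum]
  have hrow' : ∑ e, ‖z e‖ ^ 2 / 2 * ∑ e', ‖P e e'‖ ≤ ∑ e, lam e * ‖z e‖ ^ 2 / 2 :=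
    Finset.sum_le_sum fun e _ => by
      have := hrow e
      nlinarith [sq_nonneg ‖z e‖, Finset.sum_nonneg (fun e' (_ : e' ∈ univ) => norm_nonneg (P e e'))]
  have hcol' : ∑ e', ‖z e'‖ ^ 2 / 2 * ∑ e, ‖P e e'‖ ≤ ∑ e', lam e' * ‖z e'‖ ^ 2 / 2 :=
    Finset.sum_le_sum fun e' _ => by
      have := hcol e'
      nlinarith [sq_nonneg ‖z e'‖, Finset.sum_nonneg (fun e (_ : e ∈ univ) => norm_nonneg (P e e'))]
  have hhalf : ∑ e, lam e * ‖z e‖ ^ 2 / 2 = (∑ e, lam e * ‖z e‖ ^ 2) / 2 := by rw [Finset.sum_div]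
  have hre : -‖star z ⬝ᵥ (P *ᵥ z)‖ ≤ (star z ⬝ᵥ (P *ᵥ z)).re := by
    linarith [neg_abs_le ((star z ⬝ᵥ (P *ᵥ z)).re), Complex.abs_re_le_norm (star z ⬝ᵥ (P *ᵥ z))]
  linarith

omit [DecidableEq ι] in
/-- **LOCAL CONJUGATED COERCIVITY SURVIVES A SIGNED REMAINDER UP TO ITS FORM BUDGET FROM BELOW PLUS ITS SITEWISE CONJUGATION
DEFECT.**  `A` locally conjugated-coercive with profile `μ` at `(κ, ρ)`; `−θ′·Σ_e μ_e‖z_e‖² ≤ Re z^*Pz`;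
`½(expRowDefect + expColDefect)(P; κ, ρ)(e) ≤ θ·μ_e` ⟹ `A + P` is locally conjugated-coercive with profile `(1 − θ − θ′)·μ` at
`(κ, ρ)`.  (J6's `localConjCoercive_add_of_re_nonneg_budget` is the case `θ′ = 0`.) [folklore] -/
theorem localConjCoercive_add_of_lowerBounded_budget {A P : Matrix ι ι ℂ} {κ : ℝ} {ρ : ι → ℝ} {μ : ι → ℝ} {θ θ' : ℝ}
    (hcA : ∀ z : ι → ℂ, ∑ e, μ e * ‖z e‖ ^ 2 ≤ (conjForm A κ ρ z).re)
    (hP : ∀ z : ι → ℂ, -(θ' * ∑ e, μ e * ‖z e‖ ^ 2) ≤ (star z ⬝ᵥ (P *ᵥ z)).re)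
    (hJ : ∀ e, (expRowDefect P κ ρ e + expColDefect P κ ρ e) / 2 ≤ θ * μ e) (z : ι → ℂ) :
    ∑ e, (1 - θ - θ') * μ e * ‖z e‖ ^ 2 ≤ (conjForm (A + P) κ ρ z).re := by
  rw [conjForm_add, Complex.add_re]
  have h1 := hcA z
  have h2 := localLower_of_expDefect P κ ρ z
  have h3 := hP z
  have h4 : ∑ e, (expRowDefect P κ ρ e + expColDefect P κ ρ e) / 2 * ‖z e‖ ^ 2 ≤ ∑ e, θ * μ e * ‖z e‖ ^ 2 :=
    Finset.sum_le_sum fun e _ => mul_le_mul_of_nonneg_right (hJ e) (sq_nonneg _)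
  have h5 : ∑ e, (1 - θ - θ') * μ e * ‖z e‖ ^ 2
      = ∑ e, μ e * ‖z e‖ ^ 2 - ∑ e, θ * μ e * ‖z e‖ ^ 2 - θ' * ∑ e, μ e * ‖z e‖ ^ 2 := by
    rw [Finset.mul_sum, ← Finset.sum_sub_distrib, ← Finset.sum_sub_distrib]
    exact Finset.sum_congr rfl fun e _ => by ring
  linarith

/-- **DECAY OF `(A + P)⁻¹` FOR A SIGNED REMAINDER UNDER TWO SITEWISE BUDGETS.**  `A` locally conjugated-coercive with profile `μ > 0`
at rate `κ ≥ 0` along EVERY weight `d(·, j)` (`d(j,j) = 0`); `−θ′·Σ μ_e‖z_e‖² ≤ Re z^*Pz`; `½(expRowDefect + expColDefect)(P; κ, d(·,j))(e)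
≤ θ·μ_e` for every `j`; `θ + θ′ < 1`.  Then `A + P` is a unit and `‖(A + P)⁻¹(i,j)‖ ≤ e^{−κ·d(i,j)}∕((1 − θ − θ′)·√(μ_i·μ_j))`. [folklore] -/
theorem norm_inv_add_le_local_of_lowerBounded (A P : Matrix ι ι ℂ) (d : ι → ι → ℝ) (hd0 : ∀ j, d j j = 0) {κ : ℝ}
    (hκ : 0 ≤ κ) {μ : ι → ℝ} (hμ : ∀ e, 0 < μ e) {θ θ' : ℝ} (hθ : θ + θ' < 1)
    (hcA : ∀ j, ∀ z : ι → ℂ, ∑ e, μ e * ‖z e‖ ^ 2 ≤ (conjForm A κ (fun e => d e j) z).re)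
    (hP : ∀ z : ι → ℂ, -(θ' * ∑ e, μ e * ‖z e‖ ^ 2) ≤ (star z ⬝ᵥ (P *ᵥ z)).re)
    (hJ : ∀ j e, (expRowDefect P κ (fun e => d e j) e + expColDefect P κ (fun e => d e j) e) / 2 ≤ θ * μ e) (i j : ι) :
    IsUnit (A + P) ∧ ‖(A + P)⁻¹ i j‖ ≤ Real.exp (-(κ * d i j)) / ((1 - θ - θ') * Real.sqrt (μ i * μ j)) := by
  have h1θ : 0 < 1 - θ - θ' := by linarith
  have hμ' : ∀ e, 0 < (1 - θ - θ') * μ e := fun e => mul_pos h1θ (hμ e)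
  have hc : ∀ j, ∀ z : ι → ℂ, ∑ e, (1 - θ - θ') * μ e * ‖z e‖ ^ 2 ≤ (conjForm (A + P) κ (fun e => d e j) z).re :=
    fun j z => localConjCoercive_add_of_lowerBounded_budget (hcA j) hP (hJ j) z
  refine ⟨isUnit_of_localConjCoercive hμ' (hc i), ?_⟩
  have h := norm_inv_apply_le_local (A + P) d hd0 hκ hμ' (fun j z => hc j z) i j
  have hs : Real.sqrt ((1 - θ - θ') * μ i * ((1 - θ - θ') * μ j)) = (1 - θ - θ') * Real.sqrt (μ i * μ j) := by
    rw [show (1 - θ - θ') * μ i * ((1 - θ - θ') * μ j) = (1 - θ - θ') ^ 2 * (μ i * μ j) by ring,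
      Real.sqrt_mul (sq_nonneg _), Real.sqrt_sq h1θ.le]
  rwa [hs] at h

omit [Fintype ι] [DecidableEq ι] in
/-- For a symmetric `d` with the triangle inequality, `|d(e,j) − d(e′,j)| ≤ d(e,e′)`. [folklore] -/
theorem abs_sub_le_of_symm_triangle (d : ι → ι → ℝ) (hsymm : ∀ x y, d x y = d y x)
    (htri : ∀ x y z, d x z ≤ d x y + d y z) (e e' j : ι) : |d e j - d e' j| ≤ d e e' := by
  rw [abs_sub_le_iff]
  constructor
  · linarith [htri e e' j]
  · linarith [htri e' e j, hsymm e e']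

omit [DecidableEq ι] in
/-- **Sitewise defect from RANGE**: if the entries of `P` vanish across weight steps `> r` (`r ≥ 0`, `κ ≥ 0`), then
`expRowDefect P κ ρ e ≤ (Σ_{e′}‖P e e′‖)·(e^{κr} − 1)` (the tree's `expRowDefect_le_of_range` with the row sum kept sitewise). [folklore] -/
theorem expRowDefect_le_of_range_site (P : Matrix ι ι ℂ) {κ r : ℝ} (hκ : 0 ≤ κ) (ρ : ι → ℝ)
    (hR : ∀ e e', P e e' ≠ 0 → |ρ e - ρ e'| ≤ r) (e : ι) :
    expRowDefect P κ ρ e ≤ (∑ e', ‖P e e'‖) * (Real.exp (κ * r) - 1) := by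
  calc expRowDefect P κ ρ e = ∑ e', ‖P e e'‖ * expWeight κ ρ e e' := rfl
    _ ≤ ∑ e', ‖P e e'‖ * (Real.exp (κ * r) - 1) := by
        refine Finset.sum_le_sum fun e' _ => ?_
        by_cases h0 : P e e' = 0
        · simp [h0]
        · exact mul_le_mul_of_nonneg_left (expWeight_le_of_abs_sub_le hκ (hR e e' h0)) (norm_nonneg _)
    _ = (∑ e', ‖P e e'‖) * (Real.exp (κ * r) - 1) := by rw [Finset.sum_mul]

omit [DecidableEq ι] in
/-- Column version of `expRowDefect_le_of_range_site`. [folklore] -/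
theorem expColDefect_le_of_range_site (P : Matrix ι ι ℂ) {κ r : ℝ} (hκ : 0 ≤ κ) (ρ : ι → ℝ)
    (hR : ∀ e e', P e e' ≠ 0 → |ρ e - ρ e'| ≤ r) (e' : ι) :
    expColDefect P κ ρ e' ≤ (∑ e, ‖P e e'‖) * (Real.exp (κ * r) - 1) := by
  calc expColDefect P κ ρ e' = ∑ e, ‖P e e'‖ * expWeight κ ρ e e' := rfl
    _ ≤ ∑ e, ‖P e e'‖ * (Real.exp (κ * r) - 1) := by
        refine Finset.sum_le_sum fun e _ => ?_
        by_cases h0 : P e e' = 0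
        · simp [h0]
        · exact mul_le_mul_of_nonneg_left (expWeight_le_of_abs_sub_le hκ (hR e e' h0)) (norm_nonneg _)
    _ = (∑ e, ‖P e e'‖) * (Real.exp (κ * r) - 1) := by rw [Finset.sum_mul]

end Abstract

/-! ## §2 The MODEL END: `cmat levelOp + P` for a SIGNED, `d_n`-local remainder of local-gap size -/

section Model

variable {d : ℕ} {N : Fin d → ℕ} [∀ i, NeZero (N i)] [NeZero d] {Cp J K : Type} [Fintype Cp] [DecidableEq Cp] [Fintype J] [Fintype K]
  (S : J → ℕ) (hS : ∀ l, 1 ≤ S l) (hdivS : ∀ l i, S l ∣ N i) (lvl : K → J) (zc : (k : K) → Ctr N (S (lvl k)))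

/-- **THE k-UNIFORM DECAY WITH A SIGNED REMAINDER, BUDGETS DISPLAYED (MODEL).**  Setting of `MultiscaleDecay.decay_levelOp` (torus `UT N`,
covering pairwise-disjoint cube family, isometric `Rm` and `T`, `a ≥ 0`, level weights supported on their cells and print-size from above,
`|c| ≤ c_max`, cell-sum coercivity `C`, `0 ≤ κ ≤ 1`, `μ₀ := C − 2d·c_max²κ² − a_max(e^{2dκ} − 1) > 0`), plus a COMPLEX remainder `P` with
the FORM budget `−θ′·Σ_e μ₀·n(e₁)⁻²‖z_e‖² ≤ Re z^*Pz` and the sitewise conjugation-DEFECT budget `θ·μ₀·n(e₁)⁻²` along every weight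
`κ·d_n(·, q₁)`, `θ + θ′ < 1`.  Then `cmat levelOp + P` is a unit and `‖(cmat levelOp + P)⁻¹(p,q)‖ ≤ e^{−κ·d_n(p,q)}·n(p)·n(q)∕((1 − θ − θ′)·μ₀)`.
[folklore] -/
theorem decay_levelOp_add_signed
    (hdisj : ∀ k k' v v', cellPt S hS hdivS lvl zc k v = cellPt S hS hdivS lvl zc k' v' → k = k')
    (hcover : ∀ x : UT N, ∃ k, ∃ v : Box d (S (lvl k)), cellPt S hS hdivS lvl zc k v = x)
    (Rm : UT N × Fin d → Cp → Cp → ℝ) (hRm : ∀ b i j, ∑ k, Rm b k i * Rm b k j = if i = j then (1 : ℝ) else 0)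
    (T : J → UT N → Cp → Cp → ℝ) (hT : ∀ l x i i', ∑ k, T l x k i * T l x k i' = if i = i' then (1 : ℝ) else 0)
    (a : J → ℝ) (ha : ∀ j, 0 ≤ a j) (ω : J → UT N → ℝ)
    (hsupp : ∀ l x, ω l (ctrU N (S l) (tblk (hS l) (hdivS l) x)) ≠ 0 → ∃ k v, lvl k = l ∧ cellPt S hS hdivS lvl zc k v = x)
    {amax : ℝ} (hamax : 0 ≤ amax)
    (hscale : ∀ k, a (lvl k) * ω (lvl k) (ctrU N (S (lvl k)) (zc k)) ^ 2 * (S (lvl k) : ℝ) ^ d ≤ amax / (S (lvl k) : ℝ) ^ 2)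
    (c : UT N × Fin d → ℝ) {cmax : ℝ} (hc : ∀ b, |c b| ≤ cmax) {C : ℝ}
    (hcoer : ∀ f : UT N × Cp → ℝ,
      C * ∑ k, ((S (lvl k) : ℝ) ^ 2)⁻¹ * ∑ v : Box d (S (lvl k)), ∑ i, f (cellPt S hS hdivS lvl zc k v, i) ^ 2 ≤
        ∑ p, f p * levelOp bsrc btgt c Rm (fun l x => ctrU N (S l) (tblk (hS l) (hdivS l) x))
          (fun l x => ω l (ctrU N (S l) (tblk (hS l) (hdivS l) x))) T a f p)
    {κ : ℝ} (hκ0 : 0 ≤ κ) (hκ1 : κ ≤ 1) (hμ : 0 < C - 2 * d * cmax ^ 2 * κ ^ 2 - amax * (Real.exp (2 * d * κ) - 1))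
    (P : Matrix (UT N × Cp) (UT N × Cp) ℂ) {θ θ' : ℝ} (hθ : θ + θ' < 1)
    (hPform : ∀ z : UT N × Cp → ℂ,
      -(θ' * ∑ e, (C - 2 * d * cmax ^ 2 * κ ^ 2 - amax * (Real.exp (2 * d * κ) - 1)) *
          ((siteScale S hS hdivS lvl zc hcover e.1 : ℝ) ^ 2)⁻¹ * ‖z e‖ ^ 2) ≤ (star z ⬝ᵥ (P *ᵥ z)).re)
    (hJ : ∀ q e : UT N × Cp,
      (expRowDefect P κ (fun e => sdist bsrc btgt (siteScale S hS hdivS lvl zc hcover) e.1 q.1) e +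
          expColDefect P κ (fun e => sdist bsrc btgt (siteScale S hS hdivS lvl zc hcover) e.1 q.1) e) / 2 ≤
        θ * ((C - 2 * d * cmax ^ 2 * κ ^ 2 - amax * (Real.exp (2 * d * κ) - 1)) *
          ((siteScale S hS hdivS lvl zc hcover e.1 : ℝ) ^ 2)⁻¹))
    (p q : UT N × Cp) :
    IsUnit (cmat (levelOp bsrc btgt c Rm (fun l x => ctrU N (S l) (tblk (hS l) (hdivS l) x))
        (fun l x => ω l (ctrU N (S l) (tblk (hS l) (hdivS l) x))) T a) + P) ∧
      ‖(cmat (levelOp bsrc btgt c Rm (fun l x => ctrU N (S l) (tblk (hS l) (hdivS l) x))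
          (fun l x => ω l (ctrU N (S l) (tblk (hS l) (hdivS l) x))) T a) + P)⁻¹ p q‖ ≤
        Real.exp (-(κ * sdist bsrc btgt (siteScale S hS hdivS lvl zc hcover) p.1 q.1)) *
          ((siteScale S hS hdivS lvl zc hcover p.1 : ℝ) * (siteScale S hS hdivS lvl zc hcover q.1 : ℝ)) /
          ((1 - θ - θ') * (C - 2 * d * cmax ^ 2 * κ ^ 2 - amax * (Real.exp (2 * d * κ) - 1))) := by
  classical
  set n := siteScale S hS hdivS lvl zc hcover with hn
  set A := levelOp bsrc btgt c Rm (fun l x => ctrU N (S l) (tblk (hS l) (hdivS l) x))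
    (fun l x => ω l (ctrU N (S l) (tblk (hS l) (hdivS l) x))) T a with hA
  set μ₀ := C - 2 * d * cmax ^ 2 * κ ^ 2 - amax * (Real.exp (2 * d * κ) - 1) with hμ₀
  have hn0 : ∀ x, (0 : ℝ) < n x := fun x => by exact_mod_cast one_le_siteScale S hS hdivS lvl zc hcover x
  set μ : UT N × Cp → ℝ := fun e => μ₀ * ((n e.1 : ℝ) ^ 2)⁻¹ with hμdef
  have hμpos : ∀ e, 0 < μ e := fun e => mul_pos hμ (inv_pos.mpr (pow_pos (hn0 e.1) 2))
  set dd : UT N × Cp → UT N × Cp → ℝ := fun e e' => sdist bsrc btgt n e.1 e'.1 with hdd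
  have hd0 : ∀ j, dd j j = 0 := fun j => sdist_self bsrc btgt n j.1
  -- the real conjugated coercivity of `A` (MultiscaleDecay §1) read as the complex conjugated coercivity of `cmat A`
  have hcR : ∀ j, ∀ w : UT N × Cp → ℝ, ∑ e, μ e * w e ^ 2 ≤ realConjForm (LinearMap.toMatrix' A) κ (fun e => dd e j) w := by
    intro j w
    rw [realConjForm_toMatrix']
    have h := hc_levelOp S hS hdivS lvl zc hdisj hcover Rm hRm T hT a ha ω hsupp hamax hscale c hc hcoer hκ0 hκ1 j w
    refine le_trans (le_of_eq (Finset.sum_congr rfl fun e _ => ?_)) h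
    rw [hμdef]
  have hcA : ∀ j, ∀ z : UT N × Cp → ℂ, ∑ e, μ e * ‖z e‖ ^ 2 ≤ (conjForm (cmat A) κ (fun e => dd e j) z).re :=
    fun j z => localConjCoercive_of_real _ (hcR j) z
  have hP' : ∀ z : UT N × Cp → ℂ, -(θ' * ∑ e, μ e * ‖z e‖ ^ 2) ≤ (star z ⬝ᵥ (P *ᵥ z)).re := fun z => hPform z
  have hEND := norm_inv_add_le_local_of_lowerBounded (cmat A) P dd hd0 hκ0 hμpos hθ hcA hP' (fun j e => hJ j e) p q
  refine ⟨hEND.1, ?_⟩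
  -- the local prefactors
  have hsqrt : Real.sqrt (μ p * μ q) = μ₀ / ((n p.1 : ℝ) * (n q.1 : ℝ)) := by
    have hp := hn0 p.1
    have hq := hn0 q.1
    have e : μ p * μ q = (μ₀ / ((n p.1 : ℝ) * (n q.1 : ℝ))) ^ 2 := by
      rw [hμdef]
      field_simp
    rw [e, Real.sqrt_sq (div_nonneg hμ.le (mul_nonneg hp.le hq.le))]
  have h2 := hEND.2
  rw [hsqrt] at h2
  have h1θ : 0 < 1 - θ - θ' := by linarith
  have hpq : 0 < (n p.1 : ℝ) * (n q.1 : ℝ) := mul_pos (hn0 p.1) (hn0 q.1)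
  calc ‖(cmat A + P)⁻¹ p q‖ ≤ Real.exp (-(κ * dd p q)) / ((1 - θ - θ') * (μ₀ / ((n p.1 : ℝ) * (n q.1 : ℝ)))) := h2
    _ = Real.exp (-(κ * dd p q)) * ((n p.1 : ℝ) * (n q.1 : ℝ)) / ((1 - θ - θ') * μ₀) := by
        field_simp

omit [NeZero d] [DecidableEq Cp] in
/-- **THE TWO BUDGETS FROM THREE NUMBERS.**  On the torus with ANY site scale `n ≥ 1` and ANY local gap constant `m > 0`: a remainder
`P` of `d_n`-range `r ≥ 0` (`P e e′ ≠ 0 → d_n(e₁,e′₁) ≤ r`) with sitewise absolute row AND column sums `≤ β·n(e₁)⁻²` has, against the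
profile `m·n⁻²`, the FORM budget `θ′ := β∕m` (Schur, `re_form_ge_neg_of_rowCol`) and the DEFECT budget `θ := β(e^{κr} − 1)∕m` along every
weight `κ·d_n(·, j₁)` (range lemmas + `sdist_triangle_torus`), and `(1 − θ − θ′)·m = m − β·e^{κr}`. [folklore] -/
theorem budgets_of_signedLocal (n : UT N → ℕ) (hn : ∀ x, 1 ≤ n x) {m : ℝ} (hm : 0 < m) {κ : ℝ} (hκ0 : 0 ≤ κ)
    (P : Matrix (UT N × Cp) (UT N × Cp) ℂ) {r β : ℝ} (hr : 0 ≤ r)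
    (hPsupp : ∀ e e' : UT N × Cp, P e e' ≠ 0 → sdist bsrc btgt n e.1 e'.1 ≤ r)
    (hProw : ∀ e : UT N × Cp, ∑ e', ‖P e e'‖ ≤ β * ((n e.1 : ℝ) ^ 2)⁻¹)
    (hPcol : ∀ e' : UT N × Cp, ∑ e, ‖P e e'‖ ≤ β * ((n e'.1 : ℝ) ^ 2)⁻¹) :
    (1 - β * (Real.exp (κ * r) - 1) / m - β / m) * m = m - β * Real.exp (κ * r) ∧
    (∀ z : UT N × Cp → ℂ, -(β / m * ∑ e, m * ((n e.1 : ℝ) ^ 2)⁻¹ * ‖z e‖ ^ 2) ≤ (star z ⬝ᵥ (P *ᵥ z)).re) ∧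
    (∀ j e : UT N × Cp, (expRowDefect P κ (fun e => sdist bsrc btgt n e.1 j.1) e +
        expColDefect P κ (fun e => sdist bsrc btgt n e.1 j.1) e) / 2 ≤
      β * (Real.exp (κ * r) - 1) / m * (m * ((n e.1 : ℝ) ^ 2)⁻¹)) := by
  have hn0 : ∀ x, (0 : ℝ) < n x := fun x => by exact_mod_cast hn x
  have hmne : m ≠ 0 := hm.ne'
  refine ⟨?_, ?_, ?_⟩
  · field_simp
    ring
  · -- (i) the form budget from the sitewise row∕column sums (Schur)
    intro z
    have h := re_form_ge_neg_of_rowCol P (fun e => β * ((n e.1 : ℝ) ^ 2)⁻¹) hProw hPcol z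
    refine le_trans (le_of_eq ?_) h
    rw [Finset.mul_sum]
    congr 1
    refine Finset.sum_congr rfl fun e _ => ?_
    field_simp
  · -- (ii) the defect budget from the range (triangle inequality of `d_n` on the torus)
    intro j e
    have hρ : ∀ e e' : UT N × Cp, P e e' ≠ 0 → |sdist bsrc btgt n e.1 j.1 - sdist bsrc btgt n e'.1 j.1| ≤ r := by
      intro e e' hne
      refine le_trans ?_ (hPsupp e e' hne)
      exact abs_sub_le_of_symm_triangle (fun x y : UT N => sdist bsrc btgt n x y) (sdist_comm bsrc btgt n)
        (sdist_triangle_torus n) e.1 e'.1 j.1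
    have her : 0 ≤ Real.exp (κ * r) - 1 := by
      have : 0 ≤ κ * r := mul_nonneg hκ0 hr
      linarith [Real.add_one_le_exp (κ * r)]
    have hrow := (expRowDefect_le_of_range_site P hκ0 (fun e => sdist bsrc btgt n e.1 j.1) hρ e).trans
      (mul_le_mul_of_nonneg_right (hProw e) her)
    have hcol := (expColDefect_le_of_range_site P hκ0 (fun e => sdist bsrc btgt n e.1 j.1) hρ e).trans
      (mul_le_mul_of_nonneg_right (hPcol e) her)
    have heq : β * (Real.exp (κ * r) - 1) / m * (m * ((n e.1 : ℝ) ^ 2)⁻¹) = β * ((n e.1 : ℝ) ^ 2)⁻¹ * (Real.exp (κ * r) - 1) := by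
      field_simp
    rw [heq]
    linarith

/-- **THE k-UNIFORM DECAY WITH A SIGNED `d_n`-LOCAL REMAINDER OF LOCAL-GAP SIZE, BUDGETS DERIVED (MODEL) — the (81)-bookkeeping
shape.**  Setting of `MultiscaleDecay.decay_levelOp` plus a COMPLEX remainder `P` read off THREE numbers: a `d_n`-RANGE `r ≥ 0`
(`P e e′ ≠ 0 → d_n(e₁,e′₁) ≤ r`; a remainder coupling sites at lattice distance `≤ m` has `r ≤ m`, a bond's `d_n`-length being `≤ 1` —
`≤ 1∕n` inside a level-`n` cell), and sitewise ABSOLUTE ROW and COLUMN sums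
`≤ β·n(e₁)⁻²` (local-gap units; the curvature terms of [Balaban1985Variational] (79)–(81) are «O(field size)» there — J1 memo (D5)), under
the LEVEL-FREE smallness `β·e^{κr} < μ₀`.  Then `cmat levelOp + P` is a unit and
`‖(cmat levelOp + P)⁻¹(p,q)‖ ≤ e^{−κ·d_n(p,q)}·n(p)·n(q)∕(μ₀ − β·e^{κr})` — no sign condition on `P`, nothing depends on sides, levels,
their number or the volume.  (Form budget `θ′μ₀ = β` by `re_form_ge_neg_of_rowCol`; defect budget `θμ₀ = β(e^{κr} − 1)` by the range
lemmas and `sdist_triangle_torus`.) [folklore] -/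
theorem decay_levelOp_add_signedLocal
    (hdisj : ∀ k k' v v', cellPt S hS hdivS lvl zc k v = cellPt S hS hdivS lvl zc k' v' → k = k')
    (hcover : ∀ x : UT N, ∃ k, ∃ v : Box d (S (lvl k)), cellPt S hS hdivS lvl zc k v = x)
    (Rm : UT N × Fin d → Cp → Cp → ℝ) (hRm : ∀ b i j, ∑ k, Rm b k i * Rm b k j = if i = j then (1 : ℝ) else 0)
    (T : J → UT N → Cp → Cp → ℝ) (hT : ∀ l x i i', ∑ k, T l x k i * T l x k i' = if i = i' then (1 : ℝ) else 0)
    (a : J → ℝ) (ha : ∀ j, 0 ≤ a j) (ω : J → UT N → ℝ)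
    (hsupp : ∀ l x, ω l (ctrU N (S l) (tblk (hS l) (hdivS l) x)) ≠ 0 → ∃ k v, lvl k = l ∧ cellPt S hS hdivS lvl zc k v = x)
    {amax : ℝ} (hamax : 0 ≤ amax)
    (hscale : ∀ k, a (lvl k) * ω (lvl k) (ctrU N (S (lvl k)) (zc k)) ^ 2 * (S (lvl k) : ℝ) ^ d ≤ amax / (S (lvl k) : ℝ) ^ 2)
    (c : UT N × Fin d → ℝ) {cmax : ℝ} (hc : ∀ b, |c b| ≤ cmax) {C : ℝ}
    (hcoer : ∀ f : UT N × Cp → ℝ,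
      C * ∑ k, ((S (lvl k) : ℝ) ^ 2)⁻¹ * ∑ v : Box d (S (lvl k)), ∑ i, f (cellPt S hS hdivS lvl zc k v, i) ^ 2 ≤
        ∑ p, f p * levelOp bsrc btgt c Rm (fun l x => ctrU N (S l) (tblk (hS l) (hdivS l) x))
          (fun l x => ω l (ctrU N (S l) (tblk (hS l) (hdivS l) x))) T a f p)
    {κ : ℝ} (hκ0 : 0 ≤ κ) (hκ1 : κ ≤ 1) (hμ : 0 < C - 2 * d * cmax ^ 2 * κ ^ 2 - amax * (Real.exp (2 * d * κ) - 1))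
    (P : Matrix (UT N × Cp) (UT N × Cp) ℂ) {r β : ℝ} (hr : 0 ≤ r)
    (hPsupp : ∀ e e' : UT N × Cp, P e e' ≠ 0 → sdist bsrc btgt (siteScale S hS hdivS lvl zc hcover) e.1 e'.1 ≤ r)
    (hProw : ∀ e : UT N × Cp, ∑ e', ‖P e e'‖ ≤ β * ((siteScale S hS hdivS lvl zc hcover e.1 : ℝ) ^ 2)⁻¹)
    (hPcol : ∀ e' : UT N × Cp, ∑ e, ‖P e e'‖ ≤ β * ((siteScale S hS hdivS lvl zc hcover e'.1 : ℝ) ^ 2)⁻¹)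
    (hsmall : β * Real.exp (κ * r) < C - 2 * d * cmax ^ 2 * κ ^ 2 - amax * (Real.exp (2 * d * κ) - 1))
    (p q : UT N × Cp) :
    IsUnit (cmat (levelOp bsrc btgt c Rm (fun l x => ctrU N (S l) (tblk (hS l) (hdivS l) x))
        (fun l x => ω l (ctrU N (S l) (tblk (hS l) (hdivS l) x))) T a) + P) ∧
      ‖(cmat (levelOp bsrc btgt c Rm (fun l x => ctrU N (S l) (tblk (hS l) (hdivS l) x))
          (fun l x => ω l (ctrU N (S l) (tblk (hS l) (hdivS l) x))) T a) + P)⁻¹ p q‖ ≤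
        Real.exp (-(κ * sdist bsrc btgt (siteScale S hS hdivS lvl zc hcover) p.1 q.1)) *
          ((siteScale S hS hdivS lvl zc hcover p.1 : ℝ) * (siteScale S hS hdivS lvl zc hcover q.1 : ℝ)) /
          (C - 2 * d * cmax ^ 2 * κ ^ 2 - amax * (Real.exp (2 * d * κ) - 1) - β * Real.exp (κ * r)) := by
  set μ₀ := C - 2 * d * cmax ^ 2 * κ ^ 2 - amax * (Real.exp (2 * d * κ) - 1) with hμ₀
  obtain ⟨h1θ, hPform, hJ⟩ := budgets_of_signedLocal (siteScale S hS hdivS lvl zc hcover) (one_le_siteScale S hS hdivS lvl zc hcover)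
    hμ hκ0 P hr hPsupp hProw hPcol
  have hθsum : β * (Real.exp (κ * r) - 1) / μ₀ + β / μ₀ < 1 := by
    rw [← add_div, div_lt_one hμ]
    nlinarith
  have hEND := decay_levelOp_add_signed S hS hdivS lvl zc hdisj hcover Rm hRm T hT a ha ω hsupp hamax hscale c hc hcoer hκ0 hκ1 hμ
    P hθsum hPform hJ p q
  rw [h1θ] at hEND
  exact hEND

end Model

end Summit.QuantumFields.BalabanUV.T4Continuum.ShellMeasureDecaySignedRemainder

end
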